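import Mathlib
import Summits.ValiantsHypothesis.ValiantsHypothesis.Theorems.FifoMatchingNNLinearDegreeCofactorHardShedWordHeart
import Summits.ValiantsHypothesis.ValiantsHypothesis.Theorems.FifoMatchingNNLinearDegreeCofactorHardPassagePricing
import HarnessLib

/-!
# Crux `NNLinearDegreeCofactorHard` (stmt-ValiantsHypothesis-23918), line `internal_cofactor`, stub S2b (ii):
# μ* = shedWord — COINS: past-measurability of the word, the TEST kind and its forced value, and the pricing of tests
# (the API half of `…ShedWordAttribution`, LEAD spec `Lines/internal_cofactor-S2b-Dstar3-attribution-p2.md`)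

Positions `j < N` of the window are the coins (the bit `y j` is read only at fair positions).  This file supplies what the
passage pricing (`CondProbBits.card_mul_le_of_passages`) needs about μ*:

* `shedPrefix_eq_of_agree` (and `isFair_…`, `frontPos_…`) — the prefix of length `j`, hence everything decided at coin `j`, depends
  on the bits `< j` only (PAST-MEASURABILITY);
* `isTest R H E y S j` — the TEST kind: `j` is fair and the colour of position `j` differs from the colour of the front's push position;
  `isTest_eq_of_agree` — past-measurable;
* `posColour_pop` — **forced value**: if the FIFO matching of the (balanced) word respects `S` and the letter at `j` is a pop, then
  `posColour S j = posColour S (frontPos (prefix j))` (the pop closes the front's arc); so at a test coin the bit is `U` (`bit_of_isTest`);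
* `testsAll_le_card_isTest` — every test counted by the heart (`ShedWord.testsAll`) is a test coin (NS + fairness);
* `card_resp_tests_mul_le` — **pricing of tests**: the respecting bit strings of any set `A` with `≥ r` tests number at most
  `2^N / 2^r` — `card_mul_le_of_passages` with no soft coins (`P ≤ T`, `F = 0 ≤ T`).

The GATE kind (κ = 2) and the attribution inequalities for S-boundary passages are the sequel.  Nothing here proves S2b, the crux or
VP ≠ VNP (not proved). [folklore]
-/

noncomputable section

-- Sub = Summit single-conjunct layout: the duplicated namespace component is mandated by the tree.
set_option linter.dupNamespace false

namespace Summit.ValiantsHypothesis.ValiantsHypothesis.Theorems.FifoMatching.NNLinearDegreeCofactorHard.ShedWord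

open Finset Literature.Computability.AlgebraicComplexity
open Summit.ValiantsHypothesis.ValiantsHypothesis.Theorems.FifoMatching.NNMonotoneHard
open Summit.ValiantsHypothesis.ValiantsHypothesis.Theorems.FifoMatching.NNLinearDegreeCofactorHard.QueueHistory
open Summit.ValiantsHypothesis.ValiantsHypothesis.Theorems.FifoMatching.NNLinearDegreeCofactorHard.CondProbBits

variable {N : ℕ} (R : Finset (Fin N)) (H E : ℕ)

/-! ### Past-measurability -/

/-- **The prefix of length `s` depends only on the bits `< s`.** [folklore] -/
theorem shedPrefix_eq_of_agree {y y' : Fin N → Bool} {s : ℕ} (h : ∀ i : Fin N, i.val < s → y i = y' i) :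
    shedPrefix R H E y s = shedPrefix R H E y' s := by
  induction s with
  | zero => rfl
  | succ s ih =>
    have ih := ih fun i hi => h i (Nat.lt_succ_of_lt hi)
    rw [shedPrefix_succ, shedPrefix_succ, ih]
    congr 2
    unfold shedLetter
    rw [ih]
    congr 1
    unfold bit
    split_ifs with hs
    · exact h ⟨s, hs⟩ (Nat.lt_succ_self s)
    · rfl

variable (y : Fin N → Bool) (S : Finset (Fin N))

/-- The TEST kind of coin `j`: fair, and the colour of position `j` differs from the colour of the front's push position. [folklore] -/
def isTest (j : ℕ) : Bool :=
  isFair R H E y j && (posColour S j != posColour S (frontPos (shedPrefix R H E y j)))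

/-- The test kind is past-measurable. [folklore] -/
theorem isTest_eq_of_agree {y y' : Fin N → Bool} {j : ℕ} (h : ∀ i : Fin N, i.val < j → y i = y' i) :
    isTest R H E y S j = isTest R H E y' S j := by
  unfold isTest isFair; rw [shedPrefix_eq_of_agree R H E h]

/-! ### The forced value of a test coin -/

/-- **A pop closes the front's arc**: if the FIFO matching of the balanced word respects `S` and the letter at `j < N` is a pop,
the colours of `j` and of the front's push position agree. [folklore] -/
theorem posColour_pop (hbal : (closerSet (shedWord R H E y)).card = (openerSet (shedWord R H E y)).card)
    (hresp : ∀ i, i ∈ S ↔ fifo (shedWord R H E y) hbal i ∈ S) {j : ℕ} (hj : j < N) (hpop : shedLetter R H E y j = false) :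
    posColour S j = posColour S (frontPos (shedPrefix R H E y j)) := by
  classical
  have hne := (pops_lt_pushes_of_shedLetter_eq_false R H E y hpop).2.2
  have hk : pops (shedPrefix R H E y j) < (openerSet (shedWord R H E y)).card :=
    lt_of_lt_of_le hne (by rw [← pushes_shedPrefix_N]; exact pushes_mono R H E y (le_of_lt hj))
  rw [frontPos_eq_openTime R H E y (le_of_lt hj) hne]
  -- `j` is the closer of rank `pops (prefix j)`
  have hmem : (⟨j, hj⟩ : Fin N) ∈ closerSet (shedWord R H E y) := mem_closerSet.2 hpop
  have hrank : ((closerSet (shedWord R H E y)).filter fun i => i < (⟨j, hj⟩ : Fin N)).card = pops (shedPrefix R H E y j) := by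
    rw [filter_lt_fin_eq, ← pops_eq_card_closerSet R H E y (le_of_lt hj)]
  have hcl := orderEmbOfFin_card_filter_lt hbal hmem
  have hidx : (⟨((closerSet (shedWord R H E y)).filter fun i => i < (⟨j, hj⟩ : Fin N)).card,
      hbal ▸ card_filter_lt_lt_card hmem⟩ : Fin (openerSet (shedWord R H E y)).card) = ⟨pops (shedPrefix R H E y j), hk⟩ :=
    Fin.ext hrank
  rw [hidx] at hcl
  -- its partner is the opener of the same rank
  have hpartner : fifo (shedWord R H E y) hbal ⟨j, hj⟩ = (openerSet (shedWord R H E y)).orderEmbOfFin rfl ⟨pops (shedPrefix R H E y j), hk⟩ := by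
    rw [← hcl, fifo_closer]
  have hr := hresp ⟨j, hj⟩
  rw [hpartner] at hr
  unfold posColour openTime
  rw [dif_pos hk, decide_eq_decide]
  simp only [mem_map, Fin.valEmbedding_apply]
  constructor
  · rintro ⟨i, hi, he⟩
    have : i = ⟨j, hj⟩ := Fin.ext he
    subst this
    exact ⟨_, hr.1 hi, rfl⟩
  · rintro ⟨i, hi, he⟩
    rw [Fin.val_inj] at he; subst he
    exact ⟨⟨j, hj⟩, hr.2 hi, rfl⟩

/-- **At a test coin the bit is `U`** (a balanced word respecting `S`, `j < N`). [folklore] -/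
theorem bit_of_isTest (hbal : (closerSet (shedWord R H E y)).card = (openerSet (shedWord R H E y)).card)
    (hresp : ∀ i, i ∈ S ↔ fifo (shedWord R H E y) hbal i ∈ S) {j : ℕ} (hj : j < N) (ht : isTest R H E y S j = true) :
    y ⟨j, hj⟩ = true := by
  unfold isTest at ht
  rw [Bool.and_eq_true] at ht
  obtain ⟨hfair, hne⟩ := ht
  have hletter := shedLetter_of_isFair R H E y hfair
  have hbit : bit y j = y ⟨j, hj⟩ := by unfold bit; rw [dif_pos hj]
  rw [hbit] at hletter
  by_contra hb
  rw [Bool.not_eq_true] at hb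
  rw [hb] at hletter
  have := posColour_pop R H E y S hbal hresp hj hletter
  rw [this] at hne
  simp at hne

/-! ### Every counted test is a test coin -/

/-- **`testsAll ≤ #test coins`** (NS: an S-push before the tail with a non-empty queue is fair). [folklore] -/
theorem testsAll_le_card_isTest (hEN : E ≤ N) {w : ℕ} (hw : w ≤ freeCount R 0 H)
    (hband : ∀ s, H ≤ s → s ≤ E → |fairWalk R H E y s| < w) :
    testsAll R H E y S ≤ ((range N).filter fun j => isTest R H E y S j = true).card := by
  classical
  unfold testsAll sTests
  refine card_le_card fun t ht => ?_
  rw [mem_filter, mem_Ico] at ht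
  obtain ⟨⟨hHt, htE⟩, hpush, hS, hcol⟩ := ht
  have htN : t < N := lt_of_lt_of_le htE hEN
  rw [mem_filter, mem_range]
  refine ⟨htN, ?_⟩
  have hne := (sContent_mem_band R H E y hEN hw hHt (le_of_lt htE) fun s h1 h2 => hband s h1 (h2.trans (le_of_lt htE))).2
  have hd : isDefect R t = false := by rw [← isRItem_pushes R H E y htN hpush]; exact hS
  have hfront := isDefect_frontPos_eq_false_of_push R H E y hd hHt htE hne hpush
  have hfair : isFair R H E y t = true := (isFair_iff R H E y t).2 ⟨hd, hHt, hne, htE, hfront⟩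
  unfold isTest
  rw [hfair, Bool.true_and]
  rw [frontPos_eq_openTime R H E y (le_of_lt htN) hne]
  simpa using hcol

/-! ### Pricing of tests -/

/-- **Pricing of tests.**  For a balanced word whose FIFO matching respects `S` on every bit string of `A`, if every `y ∈ A` has
at least `r` test coins then `#A · (4/3)^r ≤ 2^N` (indeed `2^r`; the passage-pricing lemma with forced coins only). [folklore] -/
theorem card_resp_tests_mul_le (A : Finset (Fin N → Bool)) (r : ℕ)
    (hbal : ∀ y ∈ A, (closerSet (shedWord R H E y)).card = (openerSet (shedWord R H E y)).card)
    (hresp : ∀ y (hy : y ∈ A), ∀ i, i ∈ S ↔ fifo (shedWord R H E y) (hbal y hy) i ∈ S)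
    (hr : ∀ y ∈ A, r ≤ ((range N).filter fun j => isTest R H E y S j = true).card) :
    (A.card : ℝ) * (4 / 3 : ℝ) ^ r ≤ 2 ^ N := by
  classical
  refine card_mul_le_of_passages (J := N) (fun j v => if isTest R H E v S j = true then 1 else 0) (fun _ _ => true) ?_ A r ?_ ?_ ?_
  · intro j v w hvw
    rw [isTest_eq_of_agree R H E S hvw]
    exact ⟨rfl, rfl⟩
  · intro v hv j hj hk
    have ht : isTest R H E v S j = true := by
      by_contra h; rw [if_neg h] at hk; exact absurd hk (by norm_num)
    unfold bitAt
    rw [dif_pos hj]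
    exact bit_of_isTest R H E v S (hbal v hv) (hresp v hv) hj ht
  · intro v hv
    have : ((range N).filter fun j => (if isTest R H E v S j = true then 1 else 0) = 2 ∧ bitAt v j ≠ true).card = 0 := by
      rw [card_eq_zero, filter_eq_empty_iff]
      intro j _ h
      have := h.1
      split_ifs at this; omega
    rw [this]; exact Nat.zero_le _
  · intro v hv
    refine (hr v hv).trans ?_
    refine le_trans (le_of_eq ?_) (Nat.le_add_right _ _)
    congr 1
    ext j
    simp only [mem_filter, mem_range]
    constructor
    · rintro ⟨hj, ht⟩; exact ⟨hj, by rw [if_pos ht]⟩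
    · rintro ⟨hj, hk⟩
      refine ⟨hj, ?_⟩
      by_contra h; rw [if_neg h] at hk; exact absurd hk (by norm_num)

end Summit.ValiantsHypothesis.ValiantsHypothesis.Theorems.FifoMatching.NNLinearDegreeCofactorHard.ShedWord
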